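import Summits.HodgeConjecture.HodgeConjecture.Theorems.H413E2SW2OrbitalSumsReduction
import Literature.NumberTheory.Weil1964.FiniteWeilLevelEigenProj
import Literature.NumberTheory.Li1992.SchwartzPureTensorL2
import Literature.NumberTheory.Automorphic.AdelicPiSchwartzBruhatToLp
import Literature.NumberTheory.Automorphic.AdicCompletionCompact
import HarnessLib

/-!
# H413 ∕ E-2 ∕ `StubSW2` (ii): hypothesis `hK` of the Road-C reduction DISCHARGED for a BARE compatible splitting

Crux H413 (stmt-HodgeConjecture-24833), child line `Cruxes/H413/Lines/F0_E2SiegelWeilWeilRange.lean`, `StubSW2` (ii).  The ★ reduction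
`E2SW2OrbitalSums.orbitalSums_bounded_of_finIntegrable` (`Theorems/H413E2SW2OrbitalSumsReduction`) takes
`hK : ∀ v, ∃ K_f ≤ U(J_W)(𝔸_{F,f})` compact open, `∀ k ∈ K_f, ∃ z, ‖z‖ = 1 ∧ ω_f(1,k) v = z • v`.  THIS FILE proves `hK` for EVERY
compatible pair splitting `s` with `ω_ψ ∘ s_pair` `L²`-isometric (the letter's `hiso`), WITHOUT continuity of `s`:
* `continuous_adelicPairToSymplectic_apply` — the orbit maps `G ↦ ι(G)·w` of the dual pair's symplectic embedding are continuous
  (block formula `resAut_apply_mk`; entries, `re`, `im` continuous), hence so are the projections `u ↦ π(pairSmall₁ s (1,(1,u)))·w`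
  (★ `proj_pairSmall₁`) — the hypothesis of ★ `Weil1964.exists_finCongruenceLevel_forall_finRepMp_eq_smul_of_proj`;
* `finPairRep_level_eigen` — every `v ∈ 𝒮((𝔸_F^∞)^{N×1})` is an eigenvector of `ω_f(1,k)`, `k ∈ K_{U,f}(𝔪)`, some `𝔪 ≠ 0`;
* `norm_eq_one_of_finPairRep_eq_smul` — the eigenvalue has modulus `1`: test `hiso` on `φ₀ ⊗ R_e v` (★ `pairRep_one_finAdelicToAdelic_tmul`,
  `0 < ∫ |Φ|² < ∞` by ★ `piSchwartzBruhat_lintegral_enorm_sq_pos` ∕ `enorm_piSchwartzBruhatToLp_sq`);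
* **`hK_of_hiso`** — the hypothesis `hK`, verbatim.

KERNEL: theorems only, no `sorry`, no `Lines` import.  HC_CM is proved only modulo the printed citations until rung 0 closes.

[cite: Weil1964, Chap. I n° 11, 16–19; Chap. III n° 37–39] [cite: GelbartRogawski1991, §3.1 p. 454–455]
-/

set_option autoImplicit false
set_option linter.dupNamespace false

noncomputable section

open _root_.MeasureTheory NumberField NumberField.mixedEmbedding IsDedekindDomain Filter
open scoped ComplexConjugate TensorProduct SchwartzMap NNReal ENNReal Classical Kronecker Topology Matrix
open Literature.NumberTheory.Automorphic Literature.NumberTheory.Automorphic.UnitaryGroup Literature.NumberTheory.Weil1964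
open Literature.NumberTheory.Li1992
open Literature.NumberTheory.GelbartRogawski1991 Literature.NumberTheory.GelbartRogawski1991.UnitaryDualPair
open Literature.RepresentationTheory.HeisenbergGroup
open Summit.HodgeConjecture.HodgeConjecture.Cruxes.H413.ThetaNonvanishing

namespace Summit.HodgeConjecture.HodgeConjecture.Cruxes.H413.E2SW2OrbitalSums

section Pair

variable (F E : Type) [Field F] [NumberField F] [Field E] [NumberField E] [Algebra F E]
variable (c : E ≃ₐ[F] E) (N M : ℕ) {n : ℕ} (e : Fin N × Fin M ≃ Fin n)
variable (JV : Matrix (Fin N) (Fin N) E) (JW : Matrix (Fin M) (Fin M) E)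
variable {TV : Matrix (Fin N) (Fin N) F} {TW : Matrix (Fin M) (Fin M) F}
variable [Algebra.IsQuadraticExtension F E] {δ : E} (hcδ : c δ = -δ) (hδ : δ ≠ 0) {d : F}
  (hd : δ * δ = algebraMap F E d) (hV : TV.IsSymm) (hW : TW.IsSymm) (hVd : IsUnit TV.det) (hWd : IsUnit TW.det)
  (hJV : JV = TV.map (algebraMap F E)) (hJW : JW = TW.map (algebraMap F E))
variable {s : UnitaryGroup.adelicPair F E c N M JV JW →* adelicMpCont F (Fin n) (adelicGram F e TV TW)}
  (hs : (splittingDatum F E c N M e JV JW hcδ hδ hd hV hW hVd hWd hJV hJW).IsCompatible s)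

/-- **the orbit maps of the dual pair's symplectic embedding are continuous**: `G ↦ ι(G)·w` on `G₁(𝔸_F) = U(J_V ⊗ J_W)(𝔸_F)` (block
formula `resAut_apply_mk`: entries of `G`, `re`, `im` are continuous). [cite: Weil1964, Chap. III n° 39 p. 189] -/
theorem continuous_adelicPairToSymplectic_apply
    (w : (Fin N × Fin M → AdeleRing (𝓞 F) F) × (Fin N × Fin M → AdeleRing (𝓞 F) F)) :
    Continuous fun G : UnitaryGroup.adelicPair F E c N M JV JW =>
      ((adelicPairToSymplectic F E c N M hcδ hδ hd hV hW hJV hJW G :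
        symplecticGroup (polar (Matrix.toLinearMap₂' (AdeleRing (𝓞 F) F)
          (TV.map (algebraMap F (AdeleRing (𝓞 F) F)) ⊗ₖ TW.map (algebraMap F (AdeleRing (𝓞 F) F)))))) :
        ((Fin N × Fin M → AdeleRing (𝓞 F) F) × (Fin N × Fin M → AdeleRing (𝓞 F) F)) ≃ₗ[AdeleRing (𝓞 F) F]
          ((Fin N × Fin M → AdeleRing (𝓞 F) F) × (Fin N × Fin M → AdeleRing (𝓞 F) F))) w := by
  obtain ⟨a, b⟩ := w
  set Gre : UnitaryGroup.adelicPair F E c N M JV JW → Matrix (Fin N × Fin M) (Fin N × Fin M) (AdeleRing (𝓞 F) F) := fun G =>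
    ((G : GL (Fin N × Fin M) (AdeleRing (𝓞 E) E)) : Matrix (Fin N × Fin M) (Fin N × Fin M) (AdeleRing (𝓞 E) E)).map
      (QuadraticCoordinates.re (quadraticAdeleEquiv F E c hcδ hδ).toAddEquiv) with hGre
  set Gim : UnitaryGroup.adelicPair F E c N M JV JW → Matrix (Fin N × Fin M) (Fin N × Fin M) (AdeleRing (𝓞 F) F) := fun G =>
    ((G : GL (Fin N × Fin M) (AdeleRing (𝓞 E) E)) : Matrix (Fin N × Fin M) (Fin N × Fin M) (AdeleRing (𝓞 E) E)).map
      (QuadraticCoordinates.im (quadraticAdeleEquiv F E c hcδ hδ).toAddEquiv) with hGim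
  have key : ∀ G : UnitaryGroup.adelicPair F E c N M JV JW,
      ((adelicPairToSymplectic F E c N M hcδ hδ hd hV hW hJV hJW G :
        symplecticGroup (polar (Matrix.toLinearMap₂' (AdeleRing (𝓞 F) F)
          (TV.map (algebraMap F (AdeleRing (𝓞 F) F)) ⊗ₖ TW.map (algebraMap F (AdeleRing (𝓞 F) F)))))) :
        ((Fin N × Fin M → AdeleRing (𝓞 F) F) × (Fin N × Fin M → AdeleRing (𝓞 F) F)) ≃ₗ[AdeleRing (𝓞 F) F]
          ((Fin N × Fin M → AdeleRing (𝓞 F) F) × (Fin N × Fin M → AdeleRing (𝓞 F) F))) (a, b) =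
      (Gre G *ᵥ a + algebraMap F (AdeleRing (𝓞 F) F) d • (Gim G *ᵥ b), Gim G *ᵥ a + Gre G *ᵥ b) := fun G =>
    (isQuadraticCoordinates_adele E c hcδ hδ hd).resAut_apply_mk (Fin N × Fin M) _ a b
  simp_rw [key]
  have hre : Continuous (QuadraticCoordinates.re (quadraticAdeleEquiv F E c hcδ hδ).toAddEquiv) :=
    QuadraticCoordinates.continuous_re _ (quadraticAdeleEquiv F E c hcδ hδ).symm.continuous
  have him : Continuous (QuadraticCoordinates.im (quadraticAdeleEquiv F E c hcδ hδ).toAddEquiv) :=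
    QuadraticCoordinates.continuous_im _ (quadraticAdeleEquiv F E c hcδ hδ).symm.continuous
  have hmat : Continuous fun G : UnitaryGroup.adelicPair F E c N M JV JW =>
      ((G : GL (Fin N × Fin M) (AdeleRing (𝓞 E) E)) : Matrix (Fin N × Fin M) (Fin N × Fin M) (AdeleRing (𝓞 E) E)) :=
    Units.continuous_val.comp continuous_subtype_val
  have hreM : Continuous Gre := hmat.matrix_map hre
  have himM : Continuous Gim := hmat.matrix_map him
  exact ((hreM.matrix_mulVec continuous_const).add
    ((himM.matrix_mulVec continuous_const).const_smul (algebraMap F (AdeleRing (𝓞 F) F) d))).prodMk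
    ((himM.matrix_mulVec continuous_const).add (hreM.matrix_mulVec continuous_const))

include hs in
/-- **the projections of the finite-adelic `U(J_W)`-member are orbit-continuous**: `u ↦ π(pairSmall₁ s (1, (1,u)))·w` is continuous for
EVERY compatible `s` (★ `proj_pairSmall₁`: the projection is `ι((1,1_f) ⊗ (1,u))`). [cite: GelbartRogawski1991, §3.1 Prop. 3.1.1 p. 455] -/
theorem continuous_proj_pairSmall₁_inr_apply
    (w : (Fin N × Fin M → AdeleRing (𝓞 F) F) × (Fin N × Fin M → AdeleRing (𝓞 F) F)) :
    Continuous fun u : UnitaryGroup.finAdelic F E c M JW =>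
      ((adelicMpCont.proj F (Fin N × Fin M)
          (TV.map (algebraMap F (AdeleRing (𝓞 F) F)) ⊗ₖ TW.map (algebraMap F (AdeleRing (𝓞 F) F)))
          ((((pairSmall₁ F E c N M e JV JW s).comp (WeilCoinv.finPairToAdelic F E c N M JV JW)).comp (MonoidHom.inr _ _)) u) :
        symplecticGroup (polar (adelicForm F (Fin N × Fin M)
          (TV.map (algebraMap F (AdeleRing (𝓞 F) F)) ⊗ₖ TW.map (algebraMap F (AdeleRing (𝓞 F) F)))))) :
        ((Fin N × Fin M → AdeleRing (𝓞 F) F) × (Fin N × Fin M → AdeleRing (𝓞 F) F)) ≃ₗ[AdeleRing (𝓞 F) F]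
          ((Fin N × Fin M → AdeleRing (𝓞 F) F) × (Fin N × Fin M → AdeleRing (𝓞 F) F))) w := by
  have h : ∀ u : UnitaryGroup.finAdelic F E c M JW,
      adelicMpCont.proj F (Fin N × Fin M)
          (TV.map (algebraMap F (AdeleRing (𝓞 F) F)) ⊗ₖ TW.map (algebraMap F (AdeleRing (𝓞 F) F)))
          ((((pairSmall₁ F E c N M e JV JW s).comp (WeilCoinv.finPairToAdelic F E c N M JV JW)).comp (MonoidHom.inr _ _)) u) =
        adelicPairToSymplectic F E c N M hcδ hδ hd hV hW hJV hJW
          (UnitaryGroup.dualPair (UnitaryGroup.conjAdele F E c) (UnitaryGroup.adelicForm E N JV) (UnitaryGroup.adelicForm E M JW)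
            (WeilCoinv.finPairToAdelic F E c N M JV JW (1, u))) := fun u =>
    proj_pairSmall₁ F E c N M e JV JW hcδ hδ hd hV hW hVd hWd hJV hJW hs _
  simp_rw [h, WeilCoinv.finPairToAdelic_apply]
  exact (continuous_adelicPairToSymplectic_apply F E c N M JV JW hcδ hδ hd hV hW hJV hJW w).comp
    ((UnitaryGroup.continuous_dualPair _ _ _).comp
      (continuous_const.prodMk (UnitaryGroup.continuous_finAdelicToAdelic F E c M JW)))

/-- **LEVEL EIGENVECTORS for the finite Weil representation of the pair** (bare compatible `s`): every `v ∈ 𝒮((𝔸_F^∞)^{N×M})` satisfies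
`ω_f(1,k) v = c(k) · v` for all `k` in some principal congruence level `K_{U(J_W),f}(𝔪)`, `𝔪 ≠ 0`.
[cite: GelbartRogawski1991, §3.1 p. 454] [cite: Weil1964, Chap. III n° 37–39] -/
theorem finPairRep_level_eigen (v : FinSB F (Fin N × Fin M)) :
    ∃ 𝔪 : Ideal (𝓞 E), 𝔪 ≠ 0 ∧ ∃ χ : UnitaryGroup.finAdelic F E c M JW → ℂ,
      ∀ k ∈ UnitaryGroup.finCongruenceLevel F E c M JW 𝔪,
        WeilCoinv.finPairRep F E c N M e JV JW hcδ hδ hd hV hW hVd hWd hJV hJW hs (1, k) v = χ k • v := by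
  let σ₀ := (pairSmall₁ F E c N M e JV JW s).comp (WeilCoinv.finPairToAdelic F E c N M JV JW)
  let σ := σ₀.comp (MonoidHom.inr _ _)
  have harch : ∀ (u : UnitaryGroup.finAdelic F E c M JW) (a w : Fin N × Fin M → mixedSpace F),
      (adelicMpCont.proj F (Fin N × Fin M) _ (σ u)).1 (archVec F (Fin N × Fin M) a, archVec F (Fin N × Fin M) w) =
        (archVec F (Fin N × Fin M) a, archVec F (Fin N × Fin M) w) :=
    fun u a w => proj_pairSmall₁_finAdelic_apply_archVec F E c N M e JV JW hcδ hδ hd hV hW hVd hWd hJV hJW hs 1 u a w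
  have hrep : ∀ u, WeilCoinv.finPairRep F E c N M e JV JW hcδ hδ hd hV hW hVd hWd hJV hJW hs (1, u) =
      finRepMp (isUnit_kronecker_map F N hVd hWd) σ harch u := fun u => rfl
  obtain ⟨𝔪, h𝔪, 𝔫, heig⟩ := exists_finCongruenceLevel_forall_finRepMp_eq_smul_of_proj (isUnit_kronecker_map F N hVd hWd) σ
    (continuous_proj_pairSmall₁_inr_apply F E c N M e JV JW hcδ hδ hd hV hW hVd hWd hJV hJW hs) harch v
  exact ⟨𝔪, h𝔪, _, fun k hk => by rw [hrep]; exact heig k hk⟩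

end Pair

/-! ## The modulus of the eigenvalue from `hiso`, and `hK` -/

section Line

variable (F E : Type) [Field F] [NumberField F] [Field E] [NumberField E] [Algebra F E]
variable (c : E ≃ₐ[F] E) (N : ℕ) {n : ℕ} (e : Fin N × Fin 1 ≃ Fin n)
variable (JV : Matrix (Fin N) (Fin N) E) (JW : Matrix (Fin 1) (Fin 1) E)
variable {TV : Matrix (Fin N) (Fin N) F} {TW : Matrix (Fin 1) (Fin 1) F}
variable [Algebra.IsQuadraticExtension F E] {δ : E} (hcδ : c δ = -δ) (hδ : δ ≠ 0) {d : F}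
  (hd : δ * δ = algebraMap F E d) (hV : TV.IsSymm) (hW : TW.IsSymm) (hVd : IsUnit TV.det) (hWd : IsUnit TW.det)
  (hJV : JV = TV.map (algebraMap F E)) (hJW : JW = TW.map (algebraMap F E))
variable {s : UnitaryGroup.adelicPair F E c N 1 JV JW →* adelicMpCont F (Fin n) (adelicGram F e TV TW)}
  (hs : (splittingDatum F E c N 1 e JV JW hcδ hδ hd hV hW hVd hWd hJV hJW).IsCompatible s)
  [MeasurableSpace (AdeleRing (𝓞 F) F)] [BorelSpace (AdeleRing (𝓞 F) F)]
  (νX : Measure (Fin n → AdeleRing (𝓞 F) F)) [νX.IsAddHaarMeasure]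
  (hiso : ∀ (p : UnitaryGroup.adelic F E c N JV × UnitaryGroup.adelic F E c 1 JW) (Φ : piSchwartzBruhat F (Fin n)),
    ∫⁻ x, ‖(pairRep F E c N 1 e JV JW s p Φ : (Fin n → AdeleRing (𝓞 F) F) → ℂ) x‖ₑ ^ 2 ∂νX =
      ∫⁻ x, ‖(Φ : (Fin n → AdeleRing (𝓞 F) F) → ℂ) x‖ₑ ^ 2 ∂νX)

include hiso in
/-- **the eigenvalues of the finite Weil representation along `hiso` are unimodular**: if `ω_f(1,k) v = z • v` with `v ≠ 0` then `‖z‖ = 1`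
(test `hiso` at `(1,(1_∞,k))` on `φ₀ ⊗ R_e v`, `φ₀(0) = 1`: `ω(φ₀ ⊗ R_e v) = z • (φ₀ ⊗ R_e v)` by ★ `pairRep_one_finAdelicToAdelic_tmul`,
and `0 < ∫ |φ₀ ⊗ R_e v|² < ∞`). [cite: Weil1964, Chap. I n° 11, 13] [cite: Li1992, p. 178] -/
theorem norm_eq_one_of_finPairRep_eq_smul {v : FinSB F (Fin N × Fin 1)} (hv : v ≠ 0)
    {k : UnitaryGroup.finAdelic F E c 1 JW} {z : ℂ}
    (hz : WeilCoinv.finPairRep F E c N 1 e JV JW hcδ hδ hd hV hW hVd hWd hJV hJW hs (1, k) v = z • v) : ‖z‖ = 1 := by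
  haveI := secondCountableTopology_adeleRing F
  haveI := locallyCompactSpace_adeleRing' F
  haveI : BorelSpace (Fin n → AdeleRing (𝓞 F) F) := Pi.borelSpace
  -- the test vector `Φ = φ₀ ⊗ R_e v`
  set Φ : piSchwartzBruhat F (Fin n) :=
    piSchwartzBruhatEquiv F (Fin n) (unitSchwartz F (Fin n) ⊗ₜ finSBReindex F e v) with hΦ
  -- `ω(1,(1,k)) Φ = z • Φ`
  have hω : pairRep F E c N 1 e JV JW s (1, UnitaryGroup.finAdelicToAdelic F E c 1 JW k) Φ = z • Φ := by
    rw [hΦ, pairRep_one_finAdelicToAdelic_tmul F E c N 1 e JV JW hcδ hδ hd hV hW hVd hWd hJV hJW hs k,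
      LinearEquiv.symm_apply_apply, hz, map_smul, TensorProduct.tmul_smul, map_smul]
  -- `Φ ≠ 0`: `Φ(0_∞, y) = (R_e v)(y)` and `R_e v ≠ 0`
  have hRv : finSBReindex F e v ≠ 0 := fun h0 => hv ((finSBReindex F e).map_eq_zero_iff.1 h0)
  have hΦ0 : ((Φ : piSchwartzBruhat F (Fin n)) : (Fin n → AdeleRing (𝓞 F) F) → ℂ) ≠ 0 := by
    intro h0
    apply hRv
    apply Subtype.ext
    funext y
    have hy := congrFun h0 (piAdeleSplit F (Fin n) (0, y))
    rw [hΦ, coe_piSchwartzBruhatEquiv_tmul] at hy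
    simp only [piArch_piAdeleSplit, piFinite_piAdeleSplit, unitSchwartz_apply_zero, one_mul, Pi.zero_apply] at hy
    rw [hy]
    rfl
  -- `0 < ∫ |Φ|² < ∞`
  have hpos : 0 < ∫⁻ x, ‖((Φ : piSchwartzBruhat F (Fin n)) : (Fin n → AdeleRing (𝓞 F) F) → ℂ) x‖ₑ ^ 2 ∂νX :=
    piSchwartzBruhat_lintegral_enorm_sq_pos νX Φ.2 hΦ0
  have hfin : ∫⁻ x, ‖((Φ : piSchwartzBruhat F (Fin n)) : (Fin n → AdeleRing (𝓞 F) F) → ℂ) x‖ₑ ^ 2 ∂νX ≠ ∞ := by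
    rw [← enorm_piSchwartzBruhatToLp_sq νX Φ]
    exact ENNReal.pow_ne_top enorm_ne_top
  -- `hiso`: `‖z‖ₑ² · ∫|Φ|² = ∫|Φ|²`
  have key := hiso (1, UnitaryGroup.finAdelicToAdelic F E c 1 JW k) Φ
  rw [hω] at key
  have hsm : ∀ x, ‖((z • Φ : piSchwartzBruhat F (Fin n)) : (Fin n → AdeleRing (𝓞 F) F) → ℂ) x‖ₑ ^ 2 =
      ‖z‖ₑ ^ 2 * ‖((Φ : piSchwartzBruhat F (Fin n)) : (Fin n → AdeleRing (𝓞 F) F) → ℂ) x‖ₑ ^ 2 := fun x => by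
    rw [Submodule.coe_smul, Pi.smul_apply, smul_eq_mul, enorm_mul, mul_pow]
  simp_rw [hsm] at key
  rw [lintegral_const_mul' _ _ (ENNReal.pow_ne_top enorm_ne_top)] at key
  have h1 : ‖z‖ₑ ^ 2 = 1 := by
    have := (ENNReal.mul_left_inj hpos.ne' hfin).1 (key.trans (one_mul _).symm)
    exact this
  rw [← ofReal_norm, ← ENNReal.ofReal_pow (norm_nonneg _), ENNReal.ofReal_eq_one] at h1
  exact (pow_eq_one_iff_of_nonneg (norm_nonneg z) two_ne_zero).1 h1

include hiso in
/-- **`hK` OF THE ROAD-C REDUCTION, for every compatible `s` with `hiso`**: every `v ∈ 𝒮((𝔸_F^∞)^{N×1})` is an eigenvector with UNIMODULAR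
eigenvalues of a compact open subgroup of `U(J_W)(𝔸_{F,f})` (a principal congruence level) under `ω_f(1,·)`.
[cite: GelbartRogawski1991, §3.1 p. 454] [cite: Weil1964, Chap. III n° 37–39] -/
theorem hK_of_hiso (v : FinSB F (Fin N × Fin 1)) :
    ∃ Kf : Subgroup (UnitaryGroup.finAdelic F E c 1 JW),
      IsOpen (Kf : Set (UnitaryGroup.finAdelic F E c 1 JW)) ∧ IsCompact (Kf : Set (UnitaryGroup.finAdelic F E c 1 JW)) ∧
      ∀ k ∈ Kf, ∃ z : ℂ, ‖z‖ = 1 ∧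
        WeilCoinv.finPairRep F E c N 1 e JV JW hcδ hδ hd hV hW hVd hWd hJV hJW hs (1, k) v = z • v := by
  obtain ⟨𝔪, h𝔪, χ, hχ⟩ := finPairRep_level_eigen F E c N 1 e JV JW hcδ hδ hd hV hW hVd hWd hJV hJW hs v
  refine ⟨UnitaryGroup.finCongruenceLevel F E c 1 JW 𝔪, UnitaryGroup.isOpen_finCongruenceLevel F E c 1 JW h𝔪,
    UnitaryGroup.isCompact_finCongruenceLevel F E c 1 JW h𝔪, fun k hk => ?_⟩
  by_cases hv : v = 0
  · exact ⟨1, norm_one, by rw [hv, map_zero, smul_zero]⟩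
  · exact ⟨χ k, norm_eq_one_of_finPairRep_eq_smul F E c N e JV JW hcδ hδ hd hV hW hVd hWd hJV hJW hs νX hiso hv (hχ k hk), hχ k hk⟩

include hiso in
/-- **`StubSW2` (ii) FROM A COMPACT ARCHIMEDEAN MEMBER AND THE FINITE ABSOLUTE EULER PRODUCT ALONE**: the ★ Road-C reduction
`orbitalSums_bounded_of_finIntegrable` with its hypothesis `hK` discharged by `hK_of_hiso` — for EVERY compatible splitting `s` with `hiso`,
the orbital sums `Σ_{γ ∈ U(J_W)(F)} ‖⟨ω(1,γ)(ω(1,x₁⁻¹)Φ₁), ω(1,x₂⁻¹)Φ₂⟩‖` are summable and bounded uniformly on (compact) `C`, PROVIDED the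
finite matrix coefficients are integrable on `U(J_W)(𝔸_{F,f})` (`hF`).  Conclusion = conjunct (ii) of `StubSW2` verbatim.
[cite: Li1992, (24)–(25) p. 184] [cite: Weil1965, n° 51–52] -/
theorem orbitalSums_bounded_of_finIntegrable' [CompactSpace (UnitaryGroup.arch F E c 1 JW)]
    (hF : ∀ [MeasurableSpace (FiniteAdeleRing (𝓞 F) F)] [BorelSpace (FiniteAdeleRing (𝓞 F) F)]
      (μf : Measure (Fin n → FiniteAdeleRing (𝓞 F) F)) [μf.IsAddHaarMeasure]
      [MeasurableSpace (UnitaryGroup.finAdelic F E c 1 JW)] [BorelSpace (UnitaryGroup.finAdelic F E c 1 JW)]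
      (μb : Measure (UnitaryGroup.finAdelic F E c 1 JW)) [μb.IsHaarMeasure] (Φf Ψf : FinSB F (Fin n)),
      Integrable (fun b : UnitaryGroup.finAdelic F E c 1 JW =>
        ∫ y, ((finSBReindex F e (WeilCoinv.finPairRep F E c N 1 e JV JW hcδ hδ hd hV hW hVd hWd hJV hJW hs (1, b)
            ((finSBReindex F e).symm Φf)) : FinSB F (Fin n)) : (Fin n → FiniteAdeleRing (𝓞 F) F) → ℂ) y *
          conj ((Ψf : (Fin n → FiniteAdeleRing (𝓞 F) F) → ℂ) y) ∂μf) μb)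
    (Φ₁ Φ₂ : piSchwartzBruhat F (Fin n)) (C : Set (UnitaryGroup.adelic F E c 1 JW × UnitaryGroup.adelic F E c 1 JW))
    (hC : IsCompact C) :
    ∃ B : ℝ, ∀ (x₁ x₂ : UnitaryGroup.adelic F E c 1 JW), (x₁, x₂) ∈ C →
      Summable (fun γ : (UnitaryGroup.toAdelic F E c 1 JW).range =>
        ‖schwartzPairing F (Fin n) νX (pairRep F E c N 1 e JV JW s (1, (γ : UnitaryGroup.adelic F E c 1 JW))
            (pairRep F E c N 1 e JV JW s (1, x₁⁻¹) Φ₁)) (pairRep F E c N 1 e JV JW s (1, x₂⁻¹) Φ₂)‖) ∧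
      ∑' γ : (UnitaryGroup.toAdelic F E c 1 JW).range,
        ‖schwartzPairing F (Fin n) νX (pairRep F E c N 1 e JV JW s (1, (γ : UnitaryGroup.adelic F E c 1 JW))
            (pairRep F E c N 1 e JV JW s (1, x₁⁻¹) Φ₁)) (pairRep F E c N 1 e JV JW s (1, x₂⁻¹) Φ₂)‖ ≤ B :=
  orbitalSums_bounded_of_finIntegrable F E c N e JV JW hcδ hδ hd hV hW hVd hWd hJV hJW hs νX hiso
    (hK_of_hiso F E c N e JV JW hcδ hδ hd hV hW hVd hWd hJV hJW hs νX hiso) hF Φ₁ Φ₂ C hC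

end Line

end Summit.HodgeConjecture.HodgeConjecture.Cruxes.H413.E2SW2OrbitalSums

end
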